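import Summits.HodgeConjecture.HodgeConjecture.Theorems.MarkmanPartnerTransportPartnerTransport
import Summits.HodgeConjecture.HodgeConjecture.Theorems.MarkmanPartnerTransportPartnerExistenceOfPeriodSurjective

/-!
# Route MarkmanPartnerTransport · target `K3Sq2TypeHodge` (stmt-HodgeConjecture-19649) at Picard rank `≥ 4`
# REDUCES TO the crux `PicardThreeK3Squares` alone (modulo named facts)

With support #9 `PartnerExistence` proved modulo `Surfaces.Huybrechts_K3_periodSurjective_projective`
(`partnerExistence_of_periodSurjective`, gen 5) and support #2 `PartnerTransport` proved modulo
{`Beauville1983_hilbertSquare_markedIncidence`, `HilbertScheme.Beauville1983_hilbertSquare_blowupDiagonal_surjection`,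
`Markman2024_rationalHodgeIsometry_lift_algebraic_marked`, `Voisin2003_cupProduct_algebraicClasses`}
(`partnerTransport_of_facts`, gen 6), the `ρ(X) ≥ 4` half of the route's target is carried by the single
open crux #4:

* `hodgeConjectureFor_of_picardThreeK3Squares_of_four_le` — **(five named facts) → `PicardThreeK3Squares` →
  HC⁴ for every marked smooth projective `K3^{[2]}`-type fourfold `X` with `ρ(X) ≥ 4`** (no use of
  `IsometrySpannedThird` or `LowPicardRealMultiplication`, which only matter at `ρ(X) ≤ 3`);
* `hodgeConjectureFor_of_square_partner` — the partner form: HC⁴(X) for marked `X` with `ρ(X) ≥ 4` as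
  soon as HC⁴ holds for the square of EVERY marked projective K3 partner the period-surjectivity
  construction may return (`ρ(S) ≥ 3`, `T(S)_ℚ ≅ T(X)_ℚ` by (g1)–(g7)).

Pure logic over the two conditional theorems; CONDITIONAL (credits nothing). No definition, no sorry.
Prover seat hodge-nonav-19652-p1 (gen 6), `--supports stmt-HodgeConjecture-19649`.

References: E. Markman, Compos. Math. 160 (2024) Thm. 1.1/1.4; D. Huybrechts, *Lectures on K3 Surfaces*
Ch. 6 Thm. 3.1, Ch. 7 Thm. 4.1; A. Beauville, J. Differential Geom. 18 (1983) §6–9.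
-/

noncomputable section

set_option linter.dupNamespace false

open Module CategoryTheory MonoidalCategory
open Literature.AlgebraicTopology.SingularHomology
open Literature.AlgebraicGeometry Literature.AlgebraicGeometry.Motives Literature.AlgebraicGeometry.HodgeTheory
open Literature.AlgebraicGeometry.Hyperkaehler Literature.AlgebraicGeometry.Surfaces
open Literature.AlgebraicGeometry.HilbertScheme
open Summit.HodgeConjecture.HodgeConjecture.Theses.MarkmanPartnerTransport

namespace Summit.HodgeConjecture.HodgeConjecture.Theorems.MarkmanPartnerTransport.PartnerLattice

/-- `MarkedK3Sq[X, φ, P, z]`: VERBATIM the `let MarkedK3Sq := …` binder of the route declarations of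
MarkmanPartnerTransport (clauses (m1)–(m6)). Local notation only. -/
local notation3 (prettyPrint := false) "MarkedK3Sq[" X ", " φ ", " P ", " z "]" =>
  (((IsIntegralClass P ∧ ∀ Q : complexBetti X (2 * 4), IsIntegralClass Q → ∃ n : ℤ, Q = n • P) ∧
    (∀ c : complexBetti X 2, IsIntegralClass c ↔ ∃ v : K3HilbertIndex → ℤ, φ c = fun i => (v i : ℂ)) ∧
    (∀ a : complexBetti X 2, cupPowTwo a 4 = ((3 : ℂ) * (k3HilbertForm 2 (φ a) (φ a)) ^ 2) • P) ∧
    (IsOfHodgeType 4 X 2 2 0 (LinearEquiv.symm φ z) ∧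
      ∀ τ : complexBetti X 2, IsOfHodgeType 4 X 2 2 0 τ → ∃ t : ℂ, τ = t • LinearEquiv.symm φ z) ∧
    (∀ c : complexBetti X 2, IsOfHodgeType 4 X 2 1 1 c ↔
      (k3HilbertForm 2 (φ c) z = 0 ∧ k3HilbertForm 2 (φ c) (star z) = 0)) ∧
    (k3HilbertForm 2 z z = 0 ∧ 0 < (k3HilbertForm 2 (star z) z).re)))

/-- **HC⁴ for a marked `K3^{[2]}`-type fourfold with `ρ(X) ≥ 4` from HC⁴ of the squares of its K3
partners**: if the Hodge conjecture holds for `S × S` for every marked projective K3 surface `S` with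
`ρ(S) ≥ 3` admitting a transcendental Hodge isometry `g : H²(S) → H²(X)` ((g1)–(g7)), then it holds for
`X` — `PartnerExistence` (mod period surjectivity) supplies such a partner and `PartnerTransport` (mod the
four facts) transports. [cite: Markman2024, §1.1 Thm. 1.1 and Thm. 1.4]
[cite: Huybrechts2016K3, Ch. 6 Thm. 3.1 and Ch. 7 Thm. 4.1] -/
theorem hodgeConjectureFor_of_square_partner (hP : Huybrechts_K3_periodSurjective_projective)
    (hB : Beauville1983_hilbertSquare_markedIncidence)
    (hρ : Beauville1983_hilbertSquare_blowupDiagonal_surjection)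
    (hMk : Markman2024_rationalHodgeIsometry_lift_algebraic_marked)
    (hcup : Voisin2003_cupProduct_algebraicClasses)
    {X : SchemeOver ℂ} (hX : IsSmoothProjective 4 X) (hK : IsOfK3HilbertSquareType X)
    {φ : complexBetti X 2 ≃ₗ[ℂ] (K3HilbertIndex → ℂ)} {P : complexBetti X (2 * 4)} {z : K3HilbertIndex → ℂ}
    (hM : MarkedK3Sq[X, φ, P, z]) (h4 : 4 ≤ Module.finrank ℂ (algebraicClasses X 1))
    (hsq : ∀ (S : SchemeOver ℂ), IsK3Surface S → ∀ (η : complexBetti S (2 * 1) ≃ₗ[ℂ] (K3Index → ℂ))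
      (p : complexBetti S (2 * 2)) (x : K3Index → ℂ) (g : complexBetti S (2 * 1) →ₗ[ℂ] complexBetti X 2),
      (p ≠ 0 ∧ (IsIntegralClass p ∧ (∀ q : complexBetti S (2 * 2), IsIntegralClass q → ∃ n : ℤ, q = n • p) ∧
        (∀ c : complexBetti S (2 * 1), IsIntegralClass c ↔ ∃ v : K3Index → ℤ, η c = fun i => (v i : ℂ)) ∧
        (∀ a b : complexBetti S (2 * 1), cupProduct (rfl : 2 * 1 + 2 * 1 = 2 * 2) a b = k3Form (η a) (η b) • p) ∧
        IsOfHodgeType 2 S (2 * 1) 2 0 (LinearEquiv.symm η x) ∧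
        (∀ τ : complexBetti S (2 * 1), IsOfHodgeType 2 S (2 * 1) 2 0 τ → ∃ t : ℂ, τ = t • LinearEquiv.symm η x)) ∧
        (k3Form x x = 0 ∧ 0 < (k3Form (star x) x).re ∧ ∃ u : K3Index → ℤ,
          k3Form (fun i => (u i : ℂ)) x = 0 ∧ 0 < ∑ i, ∑ j, u i * k3Gram i j * u j)) →
      ((∀ a, IsRationalClass a → IsRationalClass (g a)) ∧
        (∀ (i j : ℕ) a, IsOfHodgeType 2 S (2 * 1) i j a → IsOfHodgeType 4 X 2 i j (g a)) ∧
        (∀ d ∈ algebraicClasses S 1, g d = 0) ∧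
        (∀ a, ∀ d : complexBetti X 2, d ∈ algebraicClasses X 1 → k3HilbertForm 2 (φ (g a)) (φ d) = 0) ∧
        (∀ a b, (∀ d ∈ algebraicClasses S 1, cupProduct (rfl : 2 * 1 + 2 * 1 = 2 * 2) a d = 0) →
          (∀ d ∈ algebraicClasses S 1, cupProduct (rfl : 2 * 1 + 2 * 1 = 2 * 2) b d = 0) →
          k3HilbertForm 2 (φ (g a)) (φ (g b)) = k3Form (η a) (η b)) ∧
        (∀ y, (∀ d : complexBetti X 2, d ∈ algebraicClasses X 1 → k3HilbertForm 2 (φ y) (φ d) = 0) →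
          ∃ a, (∀ d ∈ algebraicClasses S 1, cupProduct (rfl : 2 * 1 + 2 * 1 = 2 * 2) a d = 0) ∧ g a = y) ∧
        (∀ y, (∀ d : complexBetti X 2, d ∈ algebraicClasses X 1 → k3HilbertForm 2 (φ y) (φ d) = 0) →
          IsRationalClass y →
          ∃ a, (∀ d ∈ algebraicClasses S 1, cupProduct (rfl : 2 * 1 + 2 * 1 = 2 * 2) a d = 0) ∧
            IsRationalClass a ∧ g a = y)) →
      3 ≤ Module.finrank ℂ (algebraicClasses S 1) → HodgeConjectureFor 4 (S ⊗ S)) :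
    HodgeConjectureFor 4 X := by
  obtain ⟨S, η, p, x, g, hS, hSm, hg, hρS⟩ := partnerExistence_explicit hP hX hM h4
  exact partnerTransport_explicit hB hρ hMk hcup hX hK hM hS hSm.2.1 hSm.2.2.1 hSm.2.2.2.1 hSm.2.2.2.2
    hg.1 hg.2.1 hg.2.2.2.2.1 (hsq S hS η p x g hSm hg hρS)

/-- **At Picard rank `ρ(X) ≥ 4` the route's target `K3Sq2TypeHodge` is carried by the crux
`PicardThreeK3Squares` alone** (modulo the five named facts of `PartnerExistence` and `PartnerTransport`):
`PicardThreeK3Squares →` HC⁴ for every marked smooth projective `K3^{[2]}`-type fourfold with `ρ(X) ≥ 4`.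
The items `IsometrySpannedThird` / `LowPicardRealMultiplication` of `closes` are needed only at `ρ(X) ≤ 3`.
[cite: Markman2024, §1.1 Thm. 1.1 and Thm. 1.4] [cite: Huybrechts2016K3, Ch. 6 Thm. 3.1 and Ch. 7 Thm. 4.1] -/
theorem hodgeConjectureFor_of_picardThreeK3Squares_of_four_le (hP : Huybrechts_K3_periodSurjective_projective)
    (hB : Beauville1983_hilbertSquare_markedIncidence)
    (hρ : Beauville1983_hilbertSquare_blowupDiagonal_surjection)
    (hMk : Markman2024_rationalHodgeIsometry_lift_algebraic_marked)
    (hcup : Voisin2003_cupProduct_algebraicClasses) (h₄ : PicardThreeK3Squares)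
    {X : SchemeOver ℂ} (hX : IsSmoothProjective 4 X) (hK : IsOfK3HilbertSquareType X)
    {φ : complexBetti X 2 ≃ₗ[ℂ] (K3HilbertIndex → ℂ)} {P : complexBetti X (2 * 4)} {z : K3HilbertIndex → ℂ}
    (hM : MarkedK3Sq[X, φ, P, z]) (h4 : 4 ≤ Module.finrank ℂ (algebraicClasses X 1)) :
    HodgeConjectureFor 4 X := by
  obtain ⟨S, η, p, x, g, hS, hSm, hg, hρS⟩ := partnerExistence_of_periodSurjective hP X hX hK φ P z hM h4
  exact partnerTransport_of_facts hB hρ hMk hcup X hX hK φ P z hM S hS η p x hSm g hg (h₄ S hS η p x hSm hρS)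

end Summit.HodgeConjecture.HodgeConjecture.Theorems.MarkmanPartnerTransport.PartnerLattice

end
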